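import Summits.QuantumFields.YangMills.Theorems.BalabanUVNodesPortS1JacIntGaugeBlock
import Summits.QuantumFields.YangMills.Theorems.BalabanUVNodesPortS1JacDomGeom
import Summits.QuantumFields.YangMills.Theorems.BalabanUVNodesPortS1JacCoverDeriv
import Summits.QuantumFields.YangMills.Theorems.BalabanUVNodesPortS1Selector

/-!
# NODE O port PT-A — ROWS (c)(d) OF `stub_LZjac` ON THE WRAP CLASS, and rows (a)(b) there from the displayed statement: the torus Jacobian functional `J_T(c, 𝐔)` is `SL(2,ℂ)`-GAUGE INVARIANT
# and LOCAL IN `X(c)` as a total function (via the universal-cover bridge); the torus pieces `E_T = jacTorusPieces` satisfy `LocalOnW`, `GaugeInvOnW`, and — given the rows (a)(b) of the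
# Jacobian functional on the (1.11)–(1.16) spaces — `AnalyticOnW`, `Bound118OnW` with `E₁ = 8 Mc⁴ E e^κ` (a non-empty fibre of `X ↦ {c : X(c) = X}` has ≤ `8 Mc⁴` bonds and `d(X) ≤ 1`)

Cell `ym-nodeO-ideate`, porter seat `ymgap-nodeO-port-PTA-1` (gen 6); `--supports stmt-QuantumFields-27930` (helper); ✓ `…JacPiecesDefs`, `…JacCoverDeriv` (`jacTorus_coverBondAt`), `…JacIntGaugeBlock`
(`jacZ_gauge`), `…JacIntLocal` (`jacZ_congr`), `…JacDomGeom` (`cover_mem_domSites_domOfBond`, `dj_domOfBond_le_one`).  [I] = [Balaban1987RG1].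
* §1 `coverBondAt_valLift` (every torus bond is covered), `coverBondAt_tgt`, ★★ `jacTorus_cAct` ((1.19) for `J_T`, unconditional), ★★ `jacTorus_congr_of_agreeOnSet` ((1.7) for `J_T`),
  ★ `jacPieceT_congr_of_agreeOnSet`, ★ `jacPieceT_cAct`, ★★ `localOnW_jacTorusPieces`, ★★ `gaugeInvOnW_jacTorusPieces`.
* §2 `site_eq_of_cubeOfSite_eq_of_mod_eq`, ★ `card_fibre_domOfBond_le` ∕ `_le_eight`, ★★ `norm_jacPieceT_le` ∕ `norm_jacPieceT_le_exp`, ★ `analyticAt_jacPieceT`, ★★ `analyticOnW_jacTorusPieces`,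
  ★★ `bound118OnW_jacTorusPieces` — rows (a)(b) ON the wrap class from the per-bond rows (the content of ✓ `…JacRowsDefs.JacRowsAB`).

HONEST FRAMING.  Bookkeeping over the tree's own objects; rows (a)(b) are DERIVED FROM DISPLAYED per-bond hypotheses (not proved here); NOTHING of Bałaban's estimates asserted, ported or
discharged; `stub_LZjac` OPEN; 27930 OPEN · no claim; K0⁷∕K-Ax OPEN; NODE O 0∕1; COUNT 8∕28 · K 1∕4 UNMOVED; finite `𝕋⁴_{L^K}` at fixed ε — NOT continuum ∕ OS ∕ Clay; **the Yang–Mills mass gap is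
NOT proved by any of this.**  No `sorry`, no `def`, no `instance`, no `notation`; standard axioms.
-/

noncomputable section

open scoped BigOperators Matrix.Norms.L2Operator Topology

namespace Summit.QuantumFields.YangMills.Theorems.BalabanUVNodesPortS1

open Summit.QuantumFields.YangMills.Theorems.K0RecordFormatNames
open Literature.MathematicalPhysics.QuantumFieldTheory.Balaban1983to89
open Literature.MathematicalPhysics.QuantumFieldTheory.Balaban1983to89.Node00
open Literature.MathematicalPhysics.QuantumFieldTheory.Balaban1983to89.T4Continuum (T4Family Letter LStep)
open Literature.MathematicalPhysics.QuantumFieldTheory.Balaban1983to89.B7Prop1Explicit (e e_apply)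
open Literature.MathematicalPhysics.QuantumFieldTheory.Balaban1983to89.BlockAveragingZd (IdxZ offZ)
open Literature.MathematicalPhysics.QuantumFieldTheory.Balaban1983to89.B15Eq112TorusCover (cover)
open Literature.MathematicalPhysics.QuantumFieldTheory.Balaban1983to89.B14.Eq213MaximalDomains (cubeExt side)
open Literature.MathematicalPhysics.QuantumFieldTheory.Balaban1983to89.TreeLengthTorus (TPt IsTDom)
open Literature.MathematicalPhysics.QuantumLattice (blockMap blockSites mem_blockSites_iff)
open _root_.Matrix

/-! ## §1  Every torus coarse bond is covered; the torus Jacobian functional is `SL(2,ℂ)`-gauge invariant and window-local (via the universal-cover bridge) -/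

section TorusJ

variable {P : Params} {k : ℕ}

/-- Every bond of `T^{(j)}` is the cover of its label lift. [cite: Balaban1987RG1, (0.1) p.251 (bookkeeping)] -/
theorem coverBondAt_valLift {j : ℕ} (c : PBond P j) : coverBondAt P j ((fun i => ((c.src i).val : ℤ)), c.dir) = c := by
  cases c with
  | mk src dir =>
    show (⟨coverAt P j (fun i => ((src i).val : ℤ)), dir⟩ : PBond P j) = ⟨src, dir⟩
    rw [coverAt_valLift]

/-- The target of a covered bond is the cover of the shifted integer site. [cite: Balaban1987RG1, (0.1) p.251 (bookkeeping)] -/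
theorem coverBondAt_tgt {j : ℕ} (b : (Fin P.d → ℤ) × Fin P.d) : (coverBondAt P j b).tgt = coverAt P j (b.1 + e b.2) := by
  show (coverAt P j b.1).shift b.2 = coverAt P j (b.1 + e b.2)
  rw [coverAt_add_e]

/-- ★★ **THE TORUS JACOBIAN FUNCTIONAL IS `SL(2,ℂ)`-GAUGE INVARIANT**: `J_T(c, (𝐔, 𝐉)^u) = J_T(c, 𝐔)` for every det-one units-valued gauge transformation `u` of the fine torus and EVERY pair
(standing range) — the integer invariance `jacZ_gauge` read through the cover (`(𝐔^u) ∘ π = (𝐔 ∘ π)^{u ∘ π}` exactly). [cite: Balaban1987RG1, (1.19) p.263, (1.10) p.262] -/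
theorem jacTorus_cAct (hk : k + 1 ≤ P.m + P.K) (u : Site P 0 → (MatA 2)ˣ) (hu : ∀ x, ((u x : (MatA 2)ˣ) : MatA 2).det = 1) (φ : Sect2.CPair P (MatA 2))
    (c : PBond P (k + 1)) : jacTorus k c (Sect2.cAct u φ).1 = jacTorus k c φ.1 := by
  have hL : 2 * ((P.L - 1) / 2) + 1 = P.L := AveragingRT.two_mul_half_add_one P
  rw [← coverBondAt_valLift c, jacTorus_coverBondAt hk, jacTorus_coverBondAt hk]
  have hcfg : (fun b : (Fin P.d → ℤ) × Fin P.d => (Sect2.cAct u φ).1 (coverBondAt P 0 b)) =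
      fun b => ((u (coverAt P 0 b.1) : (MatA 2)ˣ) : MatA 2) * φ.1 (coverBondAt P 0 b) * (((u (coverAt P 0 (b.1 + e b.2)) : (MatA 2)ˣ) : MatA 2)).adjugate := by
    funext b
    show ((u (coverBondAt P 0 b).src : (MatA 2)ˣ) : MatA 2) * φ.1 (coverBondAt P 0 b) * (((u (coverBondAt P 0 b).tgt)⁻¹ : (MatA 2)ˣ) : MatA 2) = _
    rw [coverBondAt_tgt, Matrix.coe_units_inv, inv_eq_adjugate_of_det_eq_one (hu _)]
    rfl
  rw [hcfg]
  exact jacZ_gauge hL k (fun z => ((u (coverAt P 0 z) : (MatA 2)ˣ) : MatA 2)) (fun z => hu _) _ _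

end TorusJ

section TorusLoc

variable (F : T4Family)

variable {F} in
/-- ★★ **THE TORUS JACOBIAN FUNCTIONAL IS LOCAL IN `X(c)`**: two pairs agreeing on the sites of `X(c)` have the same `J_T(c, ·)` (tiled range) — the integer locality `jacZ_congr` read through the cover
with `cover_mem_domSites_domOfBond`. [cite: Balaban1987RG1, (1.7) p.261, p.267–268] -/
theorem jacTorus_congr_of_agreeOnSet {Mc k K : ℕ} (hMc : McGuard F Mc) (hK : recordK₀ F Mc k ≤ K) (c : PBond (F.P K) (k + 1))
    {φ ψ : Sect2.CPair (F.P K) (MatA 2)} (h : Sect2.agreeOnSet (Sect2.domSites (F.P K) Mc (k + 1) (domOfBond F Mc k K c)) φ ψ) :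
    jacTorus k c φ.1 = jacTorus k c ψ.1 := by
  have hL : 2 * ((F.L - 1) / 2) + 1 = F.L := AveragingRT.two_mul_half_add_one (F.P 0)
  have hk : k + 1 ≤ (F.P K).m + (F.P K).K := by rw [F.P_K]; unfold recordK₀ at hK; omega
  rw [← coverBondAt_valLift c, jacTorus_coverBondAt hk, jacTorus_coverBondAt hk]
  refine jacZ_congr hL k _ fun b hb1 hb2 => ?_
  have hsrc : (coverBondAt (F.P K) 0 b).src ∈ Sect2.domSites (F.P K) Mc (k + 1) (domOfBond F Mc k K c) :=
    cover_mem_domSites_domOfBond hMc hK c hb1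
  have htgt : (coverBondAt (F.P K) 0 b).tgt ∈ Sect2.domSites (F.P K) Mc (k + 1) (domOfBond F Mc k K c) := by
    rw [coverBondAt_tgt]
    exact cover_mem_domSites_domOfBond hMc hK c hb2
  exact (h _ hsrc htgt).1

variable {F} in
/-- ★ **THE TORUS PIECES ARE LOCAL** ((1.7) for `E_T`): pairs agreeing on the sites of `X` give the same `E_T(X, ·)` (tiled range; every summand is `J_T(c, ·)` with `X(c) = X`).
[cite: Balaban1987RG1, (1.7) p.261] -/
theorem jacPieceT_congr_of_agreeOnSet {Mc k K : ℕ} (hMc : McGuard F Mc) (hK : recordK₀ F Mc k ≤ K) (X : (recordDomSys F Mc k K).Dom)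
    {φ ψ : Sect2.CPair (F.P K) (MatA 2)} (h : Sect2.agreeOnSet (Sect2.domSites (F.P K) Mc (k + 1) X) φ ψ) :
    jacPieceT F Mc k K X φ = jacPieceT F Mc k K X ψ := by
  classical
  unfold jacPieceT
  refine congrArg Neg.neg (Finset.sum_congr rfl fun c hc => ?_)
  have hcX : domOfBond F Mc k K c = X := (Finset.mem_filter.1 hc).2
  rw [jacTorus_congr_of_agreeOnSet hMc hK c (by rw [hcX]; exact h)]

variable {F} in
/-- ★ **THE TORUS PIECES ARE `SL(2,ℂ)`-GAUGE INVARIANT** ((1.19) for `E_T`; standing range). [cite: Balaban1987RG1, (1.19) p.263] -/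
theorem jacPieceT_cAct {Mc k K : ℕ} (hk : k + 1 ≤ (F.P K).m + (F.P K).K) (X : (recordDomSys F Mc k K).Dom) (u : recordGaugeGrp F K) (φ : Sect2.CPair (F.P K) (MatA 2)) :
    jacPieceT F Mc k K X (Sect2.cAct u.1 φ) = jacPieceT F Mc k K X φ := by
  classical
  have hu : ∀ x, ((u.1 x : (MatA 2)ˣ) : MatA 2).det = 1 := fun x => B12RegularSpaces111SpecialUnitary.mem_suModel_Gc.1 (u.2 x)
  unfold jacPieceT
  refine congrArg Neg.neg (Finset.sum_congr rfl fun c _ => ?_)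
  rw [jacTorus_cAct hk u.1 hu φ c]

/-- ★★ **ROW (c) ON THE WRAP CLASS** for the δ-Jacobian torus pieces: `(jacTorusPieces F Mc k).LocalOnW F`. [cite: Balaban1987RG1, (1.7) p.261] -/
theorem localOnW_jacTorusPieces {Mc : ℕ} (hMc : McGuard F Mc) (k : ℕ) : (jacTorusPieces F Mc k).LocalOnW F :=
  fun n X _ _ _ h => jacPieceT_congr_of_agreeOnSet hMc (Nat.le_add_right _ n) X h

/-- ★★ **ROW (d) ON THE WRAP CLASS** for the δ-Jacobian torus pieces: `(jacTorusPieces F Mc k).GaugeInvOnW F`. [cite: Balaban1987RG1, (1.19) p.263] -/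
theorem gaugeInvOnW_jacTorusPieces (Mc k : ℕ) : (jacTorusPieces F Mc k).GaugeInvOnW F :=
  fun n X _ u φ => jacPieceT_cAct (succ_le_m_add_K_recordK₀ F Mc k n) X u φ

end TorusLoc

/-! ## §2  The fibre of `X` under `c ↦ X(c)` has at most `8·Mc⁴` coarse bonds; the torus pieces are bounded and analytic on the wrap class from the displayed rows -/

section Bounds

variable (F : T4Family)

variable {F} in
/-- A level-`(k+1)` site is determined by its `Mc`-cube and its remainders modulo `Mc` (tiled range). [cite: Balaban1987RG1, p.257 (bookkeeping)] -/
theorem site_eq_of_cubeOfSite_eq_of_mod_eq {Mc k K : ℕ} (hMc : McGuard F Mc) (hK : recordK₀ F Mc k ≤ K) {y y' : Site (F.P K) (k + 1)}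
    (hc : cubeOfSite F Mc k K y = cubeOfSite F Mc k K y') (hr : ∀ i, (y i).val % Mc = (y' i).val % Mc) : y = y' := by
  funext i
  apply ZMod.val_injective
  have h1 := val_cubeOfSite hMc hK y i
  have h2 := val_cubeOfSite hMc hK y' i
  have hci : (cubeOfSite F Mc k K y i).val = (cubeOfSite F Mc k K y' i).val := by rw [hc]
  rw [← Nat.div_add_mod (y i).val Mc, ← Nat.div_add_mod (y' i).val Mc, ← h1, ← h2, hci, hr i]

variable {F} in
open scoped Classical in
/-- ★ **THE FIBRE OF `X` HAS AT MOST `#cubes(X) · Mc^d · d` COARSE BONDS** (injection `c ↦ (cube of c₋, remainders of c₋ mod Mc, direction)`). [cite: Balaban1987RG1, p.257, (1.7) p.261 (bookkeeping)] -/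
theorem card_fibre_domOfBond_le {Mc k K : ℕ} (hMc : McGuard F Mc) (hK : recordK₀ F Mc k ≤ K) (X : (recordDomSys F Mc k K).Dom) :
    (Finset.univ.filter fun c : PBond (F.P K) (k + 1) => domOfBond F Mc k K c = X).card ≤ X.1.card * Mc ^ (F.P K).d * (F.P K).d := by
  classical
  have hMc0 : 0 < Mc := by obtain ⟨c, rfl⟩ := hMc; exact pow_pos (by have := F.hL.2; omega) _
  let f : PBond (F.P K) (k + 1) → (TPt (F.P K).d (Sect2.domCount (F.P K) Mc (k + 1)) × (Fin (F.P K).d → Fin Mc)) × Fin (F.P K).d :=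
    fun c => ((cubeOfSite F Mc k K c.src, fun i => ⟨(c.src i).val % Mc, Nat.mod_lt _ hMc0⟩), c.dir)
  have hinj : Set.InjOn f ↑(Finset.univ.filter fun c : PBond (F.P K) (k + 1) => domOfBond F Mc k K c = X) := by
    intro c _ c' _ h
    simp only [f, Prod.mk.injEq] at h
    obtain ⟨⟨hcube, hrem⟩, hdir⟩ := h
    have hsrc : c.src = c'.src := site_eq_of_cubeOfSite_eq_of_mod_eq hMc hK hcube fun i => by
      have := congrFun hrem i; exact congrArg Fin.val this
    cases c; cases c'; simp only at hsrc hdir; subst hsrc; subst hdir; rfl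
  have hmaps : ∀ c ∈ Finset.univ.filter (fun c : PBond (F.P K) (k + 1) => domOfBond F Mc k K c = X),
      f c ∈ (X.1 ×ˢ (Finset.univ : Finset (Fin (F.P K).d → Fin Mc))) ×ˢ (Finset.univ : Finset (Fin (F.P K).d)) := by
    intro c hc
    have hcX : domOfBond F Mc k K c = X := (Finset.mem_filter.1 hc).2
    simp only [f, Finset.mem_product, Finset.mem_univ, and_true]
    rw [← hcX]
    exact cubeOfSite_src_mem_domOfBond F Mc k K c
  calc (Finset.univ.filter fun c : PBond (F.P K) (k + 1) => domOfBond F Mc k K c = X).card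
      ≤ ((X.1 ×ˢ (Finset.univ : Finset (Fin (F.P K).d → Fin Mc))) ×ˢ (Finset.univ : Finset (Fin (F.P K).d))).card :=
        Finset.card_le_card_of_injOn f hmaps hinj
    _ = X.1.card * Mc ^ (F.P K).d * (F.P K).d := by
        rw [Finset.card_product, Finset.card_product, Finset.card_univ, Finset.card_univ, Fintype.card_fun, Fintype.card_fin, Fintype.card_fin]

variable {F} in
open scoped Classical in
/-- ★ **A NON-EMPTY FIBRE HAS AT MOST `8·Mc⁴` COARSE BONDS** (`X = X(c₀)` has at most two cubes; `d = 4`). [cite: Balaban1987RG1, p.257, (1.7) p.261 (bookkeeping)] -/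
theorem card_fibre_domOfBond_le_eight {Mc k K : ℕ} (hMc : McGuard F Mc) (hK : recordK₀ F Mc k ≤ K) (c₀ : PBond (F.P K) (k + 1)) :
    (Finset.univ.filter fun c : PBond (F.P K) (k + 1) => domOfBond F Mc k K c = domOfBond F Mc k K c₀).card ≤ 8 * Mc ^ 4 := by
  have h := card_fibre_domOfBond_le hMc hK (domOfBond F Mc k K c₀)
  have h2 := card_domOfBond_le_two F Mc k K c₀
  calc _ ≤ (domOfBond F Mc k K c₀).1.card * Mc ^ (F.P K).d * (F.P K).d := h
    _ = (domOfBond F Mc k K c₀).1.card * Mc ^ 4 * 4 := rfl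
    _ ≤ 2 * Mc ^ 4 * 4 := by gcongr
    _ = 8 * Mc ^ 4 := by ring

variable {F} in
/-- ★★ **THE TORUS PIECE IS BOUNDED BY `8·Mc⁴·E`** whenever every Jacobian term of its fibre is bounded by `E` (empty fibre: the piece is `0`). [cite: Balaban1987RG1, (1.18) p.263, p.268] -/
theorem norm_jacPieceT_le {Mc k K : ℕ} (hMc : McGuard F Mc) (hK : recordK₀ F Mc k ≤ K) (X : (recordDomSys F Mc k K).Dom) (φ : Sect2.CPair (F.P K) (MatA 2)) {E : ℝ} (hE : 0 ≤ E)
    (h : ∀ c : PBond (F.P K) (k + 1), domOfBond F Mc k K c = X → ‖jacTorus k c φ.1 - jacTorus k c 1‖ ≤ E) :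
    ‖jacPieceT F Mc k K X φ‖ ≤ 8 * (Mc : ℝ) ^ 4 * E := by
  classical
  unfold jacPieceT
  rw [norm_neg]
  by_cases hne : (Finset.univ.filter fun c : PBond (F.P K) (k + 1) => domOfBond F Mc k K c = X).Nonempty
  · obtain ⟨c₀, hc₀⟩ := hne
    have hc₀X : domOfBond F Mc k K c₀ = X := (Finset.mem_filter.1 hc₀).2
    have hcard : ((Finset.univ.filter fun c : PBond (F.P K) (k + 1) => domOfBond F Mc k K c = X).card : ℝ) ≤ 8 * (Mc : ℝ) ^ 4 := by
      rw [← hc₀X]; exact_mod_cast card_fibre_domOfBond_le_eight hMc hK c₀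
    calc ‖∑ c ∈ Finset.univ.filter (fun c : PBond (F.P K) (k + 1) => domOfBond F Mc k K c = X), (jacTorus k c φ.1 - jacTorus k c 1)‖
        ≤ ∑ c ∈ Finset.univ.filter (fun c : PBond (F.P K) (k + 1) => domOfBond F Mc k K c = X), ‖jacTorus k c φ.1 - jacTorus k c 1‖ := norm_sum_le _ _
      _ ≤ ∑ c ∈ Finset.univ.filter (fun c : PBond (F.P K) (k + 1) => domOfBond F Mc k K c = X), E :=
          Finset.sum_le_sum fun c hc => h c (Finset.mem_filter.1 hc).2
      _ = (Finset.univ.filter fun c : PBond (F.P K) (k + 1) => domOfBond F Mc k K c = X).card * E := by rw [Finset.sum_const, nsmul_eq_mul]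
      _ ≤ 8 * (Mc : ℝ) ^ 4 * E := by gcongr
  · rw [Finset.not_nonempty_iff_eq_empty.1 hne, Finset.sum_empty, norm_zero]
    positivity

variable {F} in
/-- ★★ **THE (1.18) BOUND FOR THE TORUS PIECE**: `‖E_T(X, φ)‖ ≤ (8 Mc⁴ E e^κ) · e^{−κ d(X)}` for `κ ≥ 0` (a non-empty fibre forces `X = X(c₀)`, `d(X(c₀)) ≤ 1`). [cite: Balaban1987RG1, (1.18) p.263] -/
theorem norm_jacPieceT_le_exp {Mc k K : ℕ} (hMc : McGuard F Mc) (hK : recordK₀ F Mc k ≤ K) (X : (recordDomSys F Mc k K).Dom) (φ : Sect2.CPair (F.P K) (MatA 2)) {E κ : ℝ}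
    (hE : 0 ≤ E) (hκ : 0 ≤ κ) (h : ∀ c : PBond (F.P K) (k + 1), domOfBond F Mc k K c = X → ‖jacTorus k c φ.1 - jacTorus k c 1‖ ≤ E) :
    ‖jacPieceT F Mc k K X φ‖ ≤ (8 * (Mc : ℝ) ^ 4 * E * Real.exp κ) * Real.exp (-κ * (recordDomSys F Mc k K).dj X) := by
  classical
  by_cases hne : (Finset.univ.filter fun c : PBond (F.P K) (k + 1) => domOfBond F Mc k K c = X).Nonempty
  · obtain ⟨c₀, hc₀⟩ := hne
    have hc₀X : domOfBond F Mc k K c₀ = X := (Finset.mem_filter.1 hc₀).2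
    have hdj : (recordDomSys F Mc k K).dj X ≤ 1 := by rw [← hc₀X]; exact dj_domOfBond_le_one F Mc k K c₀
    have hexp : Real.exp (-κ) ≤ Real.exp (-κ * (recordDomSys F Mc k K).dj X) := Real.exp_le_exp.2 (by nlinarith)
    calc ‖jacPieceT F Mc k K X φ‖ ≤ 8 * (Mc : ℝ) ^ 4 * E := norm_jacPieceT_le hMc hK X φ hE h
      _ = (8 * (Mc : ℝ) ^ 4 * E * Real.exp κ) * Real.exp (-κ) := by rw [mul_assoc _ (Real.exp κ), ← Real.exp_add, add_neg_cancel, Real.exp_zero, mul_one]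
      _ ≤ (8 * (Mc : ℝ) ^ 4 * E * Real.exp κ) * Real.exp (-κ * (recordDomSys F Mc k K).dj X) := by gcongr
  · have h0 : jacPieceT F Mc k K X φ = 0 := by
      unfold jacPieceT
      rw [Finset.not_nonempty_iff_eq_empty.1 hne, Finset.sum_empty, neg_zero]
    rw [h0, norm_zero]
    positivity

variable {F} in
/-- ★ **THE TORUS PIECE IS ANALYTIC** at a pair where every Jacobian term of its fibre is. [cite: Balaban1987RG1, (1.18) p.263 («analytic functions»)] -/
theorem analyticAt_jacPieceT {Mc k K : ℕ} (X : (recordDomSys F Mc k K).Dom) (φ : Sect2.CPair (F.P K) (MatA 2))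
    (h : ∀ c : PBond (F.P K) (k + 1), domOfBond F Mc k K c = X → AnalyticAt ℂ (fun ψ : Sect2.CPair (F.P K) (MatA 2) => jacTorus k c ψ.1) φ) :
    AnalyticAt ℂ (fun ψ => jacPieceT F Mc k K X ψ) φ := by
  classical
  unfold jacPieceT
  refine AnalyticAt.neg ?_
  have hfn : (fun ψ : Sect2.CPair (F.P K) (MatA 2) => ∑ c ∈ Finset.univ.filter (fun c : PBond (F.P K) (k + 1) => domOfBond F Mc k K c = X),
      (jacTorus k c ψ.1 - jacTorus k c 1)) =
      ∑ c ∈ Finset.univ.filter (fun c : PBond (F.P K) (k + 1) => domOfBond F Mc k K c = X),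
        (fun ψ : Sect2.CPair (F.P K) (MatA 2) => jacTorus k c ψ.1 - jacTorus k c 1) :=
    (Finset.sum_fn _ _).symm
  rw [hfn]
  exact Finset.analyticAt_sum _ fun c hc => (h c (Finset.mem_filter.1 hc).2).sub analyticAt_const

/-- ★★ **ROW (a) ON THE WRAP CLASS from the displayed rows.** [cite: Balaban1987RG1, (1.18) p.263] -/
theorem analyticOnW_jacTorusPieces {Mc k : ℕ} {α₀ α₁ : ℝ}
    (hA : ∀ (n : ℕ) (c : PBond (F.P (recordK₀ F Mc k + n)) (k + 1)) (φ : Sect2.CPair (F.P (recordK₀ F Mc k + n)) (MatA 2)),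
      encodeCfg F (recordK₀ F Mc k + n) φ ∈ recordUc F Mc k α₀ α₁ (recordK₀ F Mc k + n) (domOfBond F Mc k (recordK₀ F Mc k + n) c) →
        AnalyticAt ℂ (fun ψ : Sect2.CPair (F.P (recordK₀ F Mc k + n)) (MatA 2) => jacTorus k c ψ.1) φ) :
    (jacTorusPieces F Mc k).AnalyticOnW F α₀ α₁ :=
  fun n X _ φ hφ => analyticAt_jacPieceT X φ fun c hc => hA n c φ (by rw [hc]; exact hφ)

/-- ★★ **ROW (b) ON THE WRAP CLASS from the displayed rows**, constants `E₁ = 8 Mc⁴ E e^κ`, any `κ ≥ 0`. [cite: Balaban1987RG1, (1.18) p.263] -/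
theorem bound118OnW_jacTorusPieces {Mc k : ℕ} (hMc : McGuard F Mc) {α₀ α₁ E κ : ℝ} (hE : 0 ≤ E) (hκ : 0 ≤ κ)
    (hB : ∀ (n : ℕ) (c : PBond (F.P (recordK₀ F Mc k + n)) (k + 1)) (φ : Sect2.CPair (F.P (recordK₀ F Mc k + n)) (MatA 2)),
      encodeCfg F (recordK₀ F Mc k + n) φ ∈ recordUc F Mc k α₀ α₁ (recordK₀ F Mc k + n) (domOfBond F Mc k (recordK₀ F Mc k + n) c) →
        ‖jacTorus k c φ.1 - jacTorus k c 1‖ ≤ E) :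
    (jacTorusPieces F Mc k).Bound118OnW F α₀ α₁ (8 * (Mc : ℝ) ^ 4 * E * Real.exp κ) κ :=
  fun n X _ φ hφ => norm_jacPieceT_le_exp hMc (Nat.le_add_right _ n) X φ hE hκ fun c hc => hB n c φ (by rw [hc]; exact hφ)

end Bounds

end Summit.QuantumFields.YangMills.Theorems.BalabanUVNodesPortS1

end
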